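import Summits.FinalStateConjecture.FinalStateConjecture.Theorems.EIHFluxBalanceModulatedKerrHandoffOneHoleClock

/-!
# Route EIHFluxBalance — `ModulatedKerrHandoff`, stub `stub_oneHoleMatching`: `D^{≤3}` of the retarded clock

Helper file for the crux `stmt-FinalStateConjecture-10167`
(`Summit.FinalStateConjecture.FinalStateConjecture.Theses.EIHFluxBalance.ModulatedKerrHandoff`),
line `photon-rocket-modulation`, stub `stub_oneHoleMatching`; continuation of `…OneHoleClock`.

**Uniform bounds on three derivatives of the retarded clock.** For a smooth world-line `ξ` with
`‖ξ′‖ ≤ v < 1` and `‖ξ⁽ᵏ⁾‖ ≤ A` (`1 ≤ k ≤ 4`), and a retarded clock `U` (`x⁰ − U x = ‖x̲ − ξ(U x)‖`,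
smooth off the world-line), for every `r > 0` there is ONE constant `D` with
`‖Dⁱ U(x)‖ ≤ D` (`1 ≤ i ≤ 3`) at every point of retardation `x⁰ − U x ≥ r`
(`oneHole_clock_deriv_bound`). Proof: `‖D^{k+1}U‖ = ‖Dᵏ(DU)‖` and, on the open set of positive
retardation, `DU = (1 − a)⁻¹ • (dt − DN(x̲ − ξ(U)) ∘ S)` (`OneHole.fderiv_clock_eq`), whose right-hand
side is built from `U` itself, the moduli `ξ`, `ξ′`, the derivative `DN` of the Euclidean norm (uniformly
sized on `{‖z‖ ≥ r}`, `OneHole.exists_ck_fderiv_norm`) and `s ↦ (1 − s)⁻¹` on `[−v, v]`, by sums,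
pairings and compositions; the crude pointwise size calculus of `…OneHoleCalculus/Leibniz` therefore
bounds `Dᵏ(DU)` from a bound on `D^{≤k}U`, and the estimate bootstraps from `‖DU‖ ≤ 2/(1 − v)` to order
three. Kinnersley, Phys. Rev. 186 (1969) 1335, §2 (the retarded-time function and `k_μ = u_{,μ}`).
-/

noncomputable section

-- `Summit.<S>.<S>.…` (single-problem summit, D-0017) trips core's duplicate-namespace linter.
set_option linter.dupNamespace false

open Set Filter Function Literature.Geometry.Lorentzian
open scoped Topology ContDiff

namespace Summit.FinalStateConjecture.FinalStateConjecture.Theorems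

namespace OneHole

section Clock

variable {ξ : ℝ → E3} {v A r : ℝ} {Uc : E4 → ℝ}

/-- Size of the moduli `ξ′` read on the clock: `deriv ξ` has derivatives of orders `≤ 2` bounded by `A`
wherever `‖ξ⁽ᵏ⁾‖ ≤ A` for `1 ≤ k ≤ 3`. [folklore] -/
theorem ck_deriv_worldline (hξ : ContDiff ℝ ∞ ξ)
    (hA : ∀ u, ∀ k, 1 ≤ k → k ≤ 4 → ‖iteratedDeriv k ξ u‖ ≤ A) (u : ℝ) :
    ContDiffAt ℝ 2 (deriv ξ) u ∧ ∀ i ≤ 2, ‖iteratedFDeriv ℝ i (deriv ξ) u‖ ≤ A := by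
  refine ck_of_iteratedDeriv (n := 2) ((hξ.of_le (WithTop.coe_le_coe.mpr le_top)).deriv' (n := 2)).contDiffAt
    fun i hi ↦ ?_
  rw [← iteratedDeriv_succ']
  exact hA u (i + 1) (by omega) (by omega)

/-- Positive-order size of the world-line `ξ` itself (orders `1 … 2` bounded by `A`). [folklore] -/
theorem ck₁_worldline (hξ : ContDiff ℝ ∞ ξ)
    (hA : ∀ u, ∀ k, 1 ≤ k → k ≤ 4 → ‖iteratedDeriv k ξ u‖ ≤ A) (u : ℝ) :
    ContDiffAt ℝ 2 ξ u ∧ ∀ i, 1 ≤ i → i ≤ 2 → ‖iteratedFDeriv ℝ i ξ u‖ ≤ A :=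
  ck₁_of_iteratedDeriv (n := 2) (hξ.of_le (WithTop.coe_le_coe.mpr le_top)).contDiffAt fun i hi1 hi ↦
    hA u i hi1 (by omega)

/-- **The bootstrap step.** If `D^{≤k}U` (`k ≤ 2`) is bounded by `D` at all points of retardation `≥ r`,
then `D^{k+1}U` is bounded there by a constant depending only on `(k, D, v, A, r)` and the data
(crude size calculus applied to the right-hand side of `OneHole.fderiv_clock_eq`). [folklore] -/
theorem clock_bootstrap (hξ : ContDiff ℝ ∞ ξ) (hv0 : 0 ≤ v) (hv1 : v < 1)
    (hv : ∀ u, ‖deriv ξ u‖ ≤ v) (hA : ∀ u, ∀ k, 1 ≤ k → k ≤ 4 → ‖iteratedDeriv k ξ u‖ ≤ A)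
    (hclock : ∀ x, x 0 - Uc x = ‖E4.spatial x - ξ (Uc x)‖)
    (hU : ContDiffOn ℝ ∞ Uc {x : E4 | E4.spatial x ≠ ξ (Uc x)}) (hr : 0 < r) {k : ℕ} (hk : k ≤ 2)
    {D : ℝ} :
    ∃ C : ℝ, ∀ x : E4, r ≤ x 0 - Uc x →
      (ContDiffAt ℝ k Uc x ∧ ∀ i, 1 ≤ i → i ≤ k → ‖iteratedFDeriv ℝ i Uc x‖ ≤ D) →
        ‖iteratedFDeriv ℝ (k + 1) Uc x‖ ≤ C := by
  obtain ⟨BN, hBN0, hBN⟩ := exists_ck_fderiv_norm 2 hr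
  obtain ⟨Br, hBr0, hBr⟩ := exists_ck_inv_one_sub 2 hv1
  refine ⟨?_, fun x hx hUx ↦ ?_⟩
  swap
  have hx0 : x 0 - Uc x ≠ 0 := by linarith
  -- the identity `DU = RHS` near `x`
  have hev : (fun y : E4 ↦ (1 - fderiv ℝ (fun w : E3 ↦ ‖w‖) (E4.spatial y - ξ (Uc y))
      (deriv ξ (Uc y)))⁻¹ • ((EuclideanSpace.proj (0 : Fin 4) : E4 →L[ℝ] ℝ) -
        (fderiv ℝ (fun w : E3 ↦ ‖w‖) (E4.spatial y - ξ (Uc y))).comp E4.spatial)) =ᶠ[𝓝 x]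
      fderiv ℝ Uc := by
    filter_upwards [(isOpen_retardation_ne hξ hv0 hv1 hv hclock).mem_nhds hx0] with y hy
    exact (fderiv_clock_eq hξ hv0 hv1 hv hclock hU hy).symm
  rw [← norm_iteratedFDeriv_fderiv, ← (hev.iteratedFDeriv ℝ k).eq_of_nhds]
  -- sizes of the building blocks at `x`, all of order `k`
  have hZx : r ≤ ‖E4.spatial x - ξ (Uc x)‖ := by rwa [← hclock x]
  have hξU : ContDiffAt ℝ k (fun y ↦ ξ (Uc y)) x ∧
      ∀ i, 1 ≤ i → i ≤ k → ‖iteratedFDeriv ℝ i (fun y ↦ ξ (Uc y)) x‖ ≤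
        k.factorial * max A 0 * max 1 D ^ k :=
    ck₁_comp_of_ck₁ (ck₁_mono (ck₁_worldline hξ hA (Uc x)) hk le_rfl) hUx
  have hZ : ContDiffAt ℝ k (fun y ↦ E4.spatial y - ξ (Uc y)) x ∧
      ∀ i, 1 ≤ i → i ≤ k → ‖iteratedFDeriv ℝ i (fun y ↦ E4.spatial y - ξ (Uc y)) x‖ ≤
        ‖(E4.spatial : E4 →L[ℝ] E3)‖ + k.factorial * max A 0 * max 1 D ^ k :=
    ck₁_sub (ck₁_clm k (E4.spatial : E4 →L[ℝ] E3) x) hξU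
  have hDNZ := ck_comp (g := fderiv ℝ (fun w : E3 ↦ ‖w‖)) (f := fun y : E4 ↦ E4.spatial y - ξ (Uc y))
    (x := x) (ck_mono (hBN _ hZx) hk le_rfl) hZ
  have hξ'U := ck_comp (g := deriv ξ) (f := Uc) (x := x)
    (ck_mono (ck_deriv_worldline hξ hA (Uc x)) hk le_rfl) hUx
  have ha := ck_clm_apply hDNZ hξ'U
  have hax : |fderiv ℝ (fun w : E3 ↦ ‖w‖) (E4.spatial x - ξ (Uc x)) (deriv ξ (Uc x))| ≤ v :=
    (hasFDerivAt_clock hξ hv0 hv1 hv hclock hU hx0).1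
  have hra := ck_comp (g := fun s : ℝ ↦ (1 - s)⁻¹)
    (f := fun y : E4 ↦ fderiv ℝ (fun w : E3 ↦ ‖w‖) (E4.spatial y - ξ (Uc y)) (deriv ξ (Uc y)))
    (x := x) (ck_mono (hBr _ hax) hk le_rfl) (ck₁_of_ck ha)
  have hφ := ck_sub (ck_const k (EuclideanSpace.proj (0 : Fin 4) : E4 →L[ℝ] ℝ) x)
    (ck_clm_comp hDNZ (ck_const k (E4.spatial : E4 →L[ℝ] E3) x))
  have hRHS := ck_smul hra hφ
  exact hRHS.2 k le_rfl

/-- **Uniform bounds on `D^{≤3}U` at retardation `≥ r`.** For every `r > 0` there is `D ≥ 1` with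
`ContDiffAt ℝ 3 U x` and `‖Dⁱ U(x)‖ ≤ D` (`1 ≤ i ≤ 3`) whenever `x⁰ − U x ≥ r` (bootstrap of
`clock_bootstrap` from `‖DU‖ ≤ 2/(1 − v)`). Kinnersley 1969, §2. [folklore] -/
theorem exists_clock_deriv_bound (hξ : ContDiff ℝ ∞ ξ) (hv0 : 0 ≤ v) (hv1 : v < 1)
    (hv : ∀ u, ‖deriv ξ u‖ ≤ v) (hA : ∀ u, ∀ k, 1 ≤ k → k ≤ 4 → ‖iteratedDeriv k ξ u‖ ≤ A)
    (hclock : ∀ x, x 0 - Uc x = ‖E4.spatial x - ξ (Uc x)‖)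
    (hU : ContDiffOn ℝ ∞ Uc {x : E4 | E4.spatial x ≠ ξ (Uc x)}) (hr : 0 < r) :
    ∃ D : ℝ, 1 ≤ D ∧ ∀ x : E4, r ≤ x 0 - Uc x →
      ContDiffAt ℝ 3 Uc x ∧ ∀ i, 1 ≤ i → i ≤ 3 → ‖iteratedFDeriv ℝ i Uc x‖ ≤ D := by
  have hcd : ∀ x : E4, r ≤ x 0 - Uc x → ∀ n : ℕ, ContDiffAt ℝ n Uc x := fun x hx n ↦
    contDiffAt_clock hξ hv0 hv1 hv hclock hU (by linarith) (WithTop.coe_le_coe.mpr le_top)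
  -- order 1
  set D₁ : ℝ := max 1 (2 / (1 - v)) with hD₁
  have h1 : ∀ x : E4, r ≤ x 0 - Uc x →
      ContDiffAt ℝ 1 Uc x ∧ ∀ i, 1 ≤ i → i ≤ 1 → ‖iteratedFDeriv ℝ i Uc x‖ ≤ D₁ := by
    intro x hx
    refine ⟨hcd x hx 1, fun i hi1 hi ↦ ?_⟩
    obtain rfl : i = 1 := le_antisymm hi hi1
    rw [← norm_iteratedFDeriv_fderiv, norm_iteratedFDeriv_zero]
    exact (norm_fderiv_clock_le hξ hv0 hv1 hv hclock hU (by linarith)).trans (le_max_right _ _)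
  -- order 2
  obtain ⟨C₁, hC₁⟩ := clock_bootstrap hξ hv0 hv1 hv hA hclock hU hr (k := 1) (by norm_num) (D := D₁)
  set D₂ : ℝ := max D₁ C₁ with hD₂
  have h2 : ∀ x : E4, r ≤ x 0 - Uc x →
      ContDiffAt ℝ 2 Uc x ∧ ∀ i, 1 ≤ i → i ≤ 2 → ‖iteratedFDeriv ℝ i Uc x‖ ≤ D₂ := by
    intro x hx
    refine ⟨hcd x hx 2, fun i hi1 hi ↦ ?_⟩
    rcases (show i = 1 ∨ i = 2 by omega) with rfl | rfl
    · exact ((h1 x hx).2 1 le_rfl le_rfl).trans (le_max_left _ _)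
    · exact (hC₁ x hx (h1 x hx)).trans (le_max_right _ _)
  -- order 3
  obtain ⟨C₂, hC₂⟩ := clock_bootstrap hξ hv0 hv1 hv hA hclock hU hr (k := 2) le_rfl (D := D₂)
  refine ⟨max D₂ C₂, le_max_of_le_left ((le_max_left _ _).trans (le_max_left _ _)), fun x hx ↦
    ⟨hcd x hx 3, fun i hi1 hi ↦ ?_⟩⟩
  rcases (show i ≤ 2 ∨ i = 3 by omega) with hi2 | rfl
  · exact ((h2 x hx).2 i hi1 hi2).trans (le_max_left _ _)
  · exact (hC₂ x hx (h2 x hx)).trans (le_max_right _ _)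

end Clock

end OneHole

/-- Registered sub-goal form (stub `oneHole_clock_deriv_bound` of the crux item) of
`OneHole.exists_clock_deriv_bound`: uniform bounds on three derivatives of the retarded clock at
retardation `≥ r > 0` (Kinnersley 1969, §2). [folklore] -/
theorem oneHole_clock_deriv_bound : open Literature.Geometry.Lorentzian in ∀ {ξ : ℝ → E3} {v A r : ℝ} {Uc : E4 → ℝ}, ContDiff ℝ ((⊤ : ℕ∞) : WithTop ℕ∞) ξ → 0 ≤ v → v < 1 → (∀ u, ‖deriv ξ u‖ ≤ v) → (∀ u, ∀ k, 1 ≤ k → k ≤ 4 → ‖iteratedDeriv k ξ u‖ ≤ A) → (∀ x, x 0 - Uc x = ‖E4.spatial x - ξ (Uc x)‖) → ContDiffOn ℝ ((⊤ : ℕ∞) : WithTop ℕ∞) Uc {x : E4 | E4.spatial x ≠ ξ (Uc x)} → 0 < r → ∃ D : ℝ, 1 ≤ D ∧ ∀ x : E4, r ≤ x 0 - Uc x → ContDiffAt ℝ 3 Uc x ∧ ∀ i, 1 ≤ i → i ≤ 3 → ‖iteratedFDeriv ℝ i Uc x‖ ≤ D :=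
  fun hξ hv0 hv1 hv hA hclock hU hr ↦ OneHole.exists_clock_deriv_bound hξ hv0 hv1 hv hA hclock hU hr

end Summit.FinalStateConjecture.FinalStateConjecture.Theorems

end
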